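import Summits.AnomalousDissipation.AnomalousDissipation.Theorems.SawtoothPulseCascadeK1LocalisedCascadeBlockScalarsCT
import Summits.AnomalousDissipation.AnomalousDissipation.Theorems.SawtoothPulseCascadeK1LocalisedCascadeClassBlocksOsc

/-!
# K1loc, line `Spectral` — helper: ONE FIBRE BLOCK OF A CLASS STEP, CORNER-TRACE GRADE (S-D, arbiter A24-4: p1 types the
phase-3 CT class-level sums; this is the block brick of `…ClassBlocksCT`)

`…ClassBlocksOsc.sum_block_iterate_{v,h}step_osc_le` re-run over the CT blocks `…BlockScalarsCT.sum_window_iterate_{v,h}step_ct_box_le`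
(all scalars discharged): the block `W ∩ {Λ ≤ |k_i| < Λt}` of a finite window, blockwise plateau `p`, sources `|l| ≤ L + R`
(box trapezoid, plateau `L`, ramps `R`), a REAL lower bound `D_m > 0` of the gaps `|k_i|G − p(k_i)` (rounded up to `⌈D_m⌉`
internally; the junk is antitone in the gap), a window symmetric under `k_i ↦ −k_i`, zone parameter `M`, `e^{−M²/2} ≤ ε`.
Junk per block: `√J_CT + √J_round`,
`J_CT = 3N_jσ/π²·2N_j(Θ/2+Θ/2) + 12N_j²(L+R)²(2(L+R)/N_j+1)σ/(π²D_m²)`, `σ = 1/(D_m+L+R)² + 1/(N_j(D_m+L+R))`,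
`Θ = (√((2L+R)R)/R)²`, `J_round = (πΛtGε/N_j)² + 8Mδ_j(Θ/2+Θ/2)/π`; pass-through in the half-open form.
-/

-- `Summit.<Summit>.<Problem>`: single-conjunct summit, the duplicate namespace segment is deliberate.
set_option linter.dupNamespace false

namespace Summit.AnomalousDissipation.AnomalousDissipation.Theorems.SawtoothPulseCascade.K1Window

open MeasureTheory Set Filter Topology UnitAddTorus Function Complex Metric
open scoped Real ENNReal
open Literature.Analysis Literature.Analysis.FunctionSpaces Literature.Analysis.FunctionSpaces.Torus Literature.Analysis.FluidPDE
open Literature.Analysis.FluidPDE.ShearStage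
open Literature.Analysis.FluidPDE.SawtoothCascade Literature.Analysis.FluidPDE.SawtoothCascade.CascadeParams
open Summit.AnomalousDissipation.AnomalousDissipation.Theorems.SawtoothPulseCascade.K1Start
open Summit.AnomalousDissipation.AnomalousDissipation.Theorems.SawtoothPulseCascade.K1Flat
open Summit.AnomalousDissipation.AnomalousDissipation.Theorems.SawtoothPulseCascade.K1Ledger.From

/-- **The CT block junk is antitone in the gap**: for `0 < D ≤ D'` the junk `3Nσ(D)/π²·Θs + 12N²Q²M_cσ(D)/(π²D²)·1`,
`σ(D) = 1/(D+Q)² + 1/(N(D+Q))`, at `D'` is at most the junk at `D`. [folklore] -/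
theorem ctJunk_mono {N Q Mc Θs D D' : ℝ} (hN : 0 < N) (hQ : 0 ≤ Q) (hMc : 0 ≤ Mc) (hΘ : 0 ≤ Θs) (hD : 0 < D)
    (hDD' : D ≤ D') :
    3 * N * (1 / (D' + Q) ^ 2 + 1 / (N * (D' + Q))) / π ^ 2 * Θs +
        12 * N ^ 2 * Q ^ 2 * Mc * (1 / (D' + Q) ^ 2 + 1 / (N * (D' + Q))) / (π ^ 2 * D' ^ 2) * 1 ≤
      3 * N * (1 / (D + Q) ^ 2 + 1 / (N * (D + Q))) / π ^ 2 * Θs +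
        12 * N ^ 2 * Q ^ 2 * Mc * (1 / (D + Q) ^ 2 + 1 / (N * (D + Q))) / (π ^ 2 * D ^ 2) * 1 := by
  have hπ : 0 < π := Real.pi_pos
  have hDQ : 0 < D + Q := by linarith
  have hσ : 1 / (D' + Q) ^ 2 + 1 / (N * (D' + Q)) ≤ 1 / (D + Q) ^ 2 + 1 / (N * (D + Q)) :=
    add_le_add (one_div_le_one_div_of_le (by positivity) (by nlinarith))
      (one_div_le_one_div_of_le (by positivity) (by nlinarith))
  have hσ0 : 0 ≤ 1 / (D' + Q) ^ 2 + 1 / (N * (D' + Q)) := by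
    have : 0 < D' + Q := by linarith
    positivity
  refine add_le_add ?_ ?_
  · exact mul_le_mul_of_nonneg_right (div_le_div_of_nonneg_right (mul_le_mul_of_nonneg_left hσ (by positivity))
      (by positivity)) hΘ
  · refine mul_le_mul_of_nonneg_right ?_ zero_le_one
    have hnum : 12 * N ^ 2 * Q ^ 2 * Mc * (1 / (D' + Q) ^ 2 + 1 / (N * (D' + Q))) ≤
        12 * N ^ 2 * Q ^ 2 * Mc * (1 / (D + Q) ^ 2 + 1 / (N * (D + Q))) := mul_le_mul_of_nonneg_left hσ (by positivity)
    have hden : π ^ 2 * D ^ 2 ≤ π ^ 2 * D' ^ 2 := mul_le_mul_of_nonneg_left (by nlinarith) (by positivity)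
    exact (div_le_div_of_nonneg_right hnum (by positivity)).trans
      (div_le_div_of_nonneg_left (by positivity) (by positivity) hden)

section Cascade

variable (P : CascadeParams)

/-- **One fibre block of a V-window of `a_{j+1}`, CT grade** (see the file header): `…BlockScalarsCT.sum_window_iterate_vstep_ct_box_le`
on the block `W ∩ {Λ ≤ |k₁| < Λt}` with a real gap bound `D_m` and the junk written at `D_m` and at the block top `Λt`.
[cite: Grafakos2014, Prop. 3.1.2 (5), Prop. 3.2.7 (3)] -/
theorem sum_block_iterate_vstep_ct_le {G : ℕ} (hγ : P.γ = G) (hδ₀ : 0 < P.δ₀) (hd : 0 < P.d) (hN₀ : 1 ≤ P.N₀)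
    (hρN : 1 ≤ P.ρN) (a b : ℕ → UnitAddTorus (Fin 2) → ℝ) (has : ∀ j, IsSmooth (a j)) (h0 : a 0 = datum)
    (hb : ∀ j, b j = a j ∘ shearMap 0 1 (amp ⟨P.U j, P.U_periodic j, P.contDiff_U (P.δ_pos hδ₀ hd j)⟩ P.γ))
    (hab : ∀ j, a (j + 1) = b j ∘ shearMap 1 0 (amp ⟨P.U j, P.U_periodic j, P.contDiff_U (P.δ_pos hδ₀ hd j)⟩ P.γ))
    (j : ℕ) (p : ℤ → ℕ) (W : Finset (Fin 2 → ℤ)) {Λ Λt L R : ℕ} (hΛt : 1 ≤ Λt) (hR : 0 < R)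
    (hWp : ∀ k ∈ W, (Λ : ℤ) ≤ |k 1| → |k 1| < (Λt : ℤ) → |k 0| + ((L + R : ℕ) : ℤ) ≤ (p (k 1) : ℤ))
    {Dm : ℝ} (hDm : 0 < Dm)
    (hD : ∀ k ∈ W, (Λ : ℤ) ≤ |k 1| → |k 1| < (Λt : ℤ) → Dm ≤ (((k 1).natAbs * G : ℕ) : ℝ) - p (k 1))
    (hWsym : ∀ k ∈ W, Function.update k 1 (-k 1) ∈ W)
    {M ε : ℝ} (hM : 1 ≤ M) (hMδ : M * P.δ j < π / 2) (hε : Real.exp (-(M ^ 2 / 2)) ≤ ε) :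
    ∑ k ∈ W.filter (fun k => (Λ : ℤ) ≤ |k 1| ∧ |k 1| < (Λt : ℤ)), ‖mFourierCoeff (fun x => (a (j + 1) x : ℂ)) k‖ ^ 2 ≤
      (Real.sqrt (3 * P.N j * (1 / (Dm + ((L + R : ℕ) : ℝ)) ^ 2 + 1 / (P.N j * (Dm + ((L + R : ℕ) : ℝ)))) /
              π ^ 2 * (2 * P.N j * ((Real.sqrt ((2 * L + R : ℕ) * R) / R * 1) ^ 2 / 2 +
                (Real.sqrt ((2 * L + R : ℕ) * R) / R * 1) ^ 2 / 2)) +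
            12 * (P.N j : ℝ) ^ 2 * ((L + R : ℕ) : ℝ) ^ 2 * (2 * ((L + R : ℕ) : ℝ) / P.N j + 1) *
              (1 / (Dm + ((L + R : ℕ) : ℝ)) ^ 2 + 1 / (P.N j * (Dm + ((L + R : ℕ) : ℝ)))) /
              (π ^ 2 * Dm ^ 2) * 1) +
          Real.sqrt ((π * ((Λt * G : ℕ) : ℝ) * ε / P.N j) ^ 2 * 1 +
            8 * M * P.δ j / π * ((Real.sqrt ((2 * L + R : ℕ) * R) / R * 1) ^ 2 / 2 +
              (Real.sqrt ((2 * L + R : ℕ) * R) / R * 1) ^ 2 / 2)) +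
        Real.sqrt (∑' k : Fin 2 → ℤ, (if (Λ : ℤ) ≤ |k 1| ∧ |k 1| < (Λt : ℤ) ∧ (L : ℤ) < |k 0| then (1 : ℝ) else 0) *
          ‖mFourierCoeff (fun x => (b j x : ℂ)) k‖ ^ 2)) ^ 2 := by
  classical
  have hNpos : 0 < P.N j := N_pos P hN₀ hρN j
  have hNr : (0 : ℝ) < P.N j := by exact_mod_cast hNpos
  have hε0 : 0 ≤ ε := (Real.exp_pos _).le.trans hε
  set Wm : Finset (Fin 2 → ℤ) := W.filter (fun k => (Λ : ℤ) ≤ |k 1| ∧ |k 1| < (Λt : ℤ)) with hWm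
  have hmem : ∀ k ∈ Wm, k ∈ W ∧ (Λ : ℤ) ≤ |k 1| ∧ |k 1| < (Λt : ℤ) := fun k hk => by
    simpa [hWm, Finset.mem_filter] using hk
  have hcast : (((Λt - 1 : ℕ) : ℤ)) = (Λt : ℤ) - 1 := by push_cast [Nat.cast_sub hΛt]; ring
  have hW' : ∀ k ∈ Wm, (Λ : ℤ) ≤ |k 1| ∧ |k 1| ≤ ((Λt - 1 : ℕ) : ℤ) := fun k hk => by
    obtain ⟨-, h1, h2⟩ := hmem k hk
    exact ⟨h1, by rw [hcast]; exact Int.le_sub_one_iff.mpr h2⟩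
  have hWp' : ∀ k ∈ Wm, |k 0| + ((L + R : ℕ) : ℤ) ≤ (p (k 1) : ℤ) := fun k hk => by
    obtain ⟨hkW, h1, h2⟩ := hmem k hk; exact hWp k hkW h1 h2
  -- the integer gap `⌈D_m⌉`
  set D : ℕ := ⌈Dm⌉₊ with hDdef
  have hD0 : 0 < D := Nat.ceil_pos.mpr hDm
  have hDle : Dm ≤ (D : ℝ) := Nat.le_ceil Dm
  have hD' : ∀ k ∈ Wm, (p (k 1) : ℤ) + D ≤ |k 1| * G := by
    intro k hk
    obtain ⟨hkW, h1, h2⟩ := hmem k hk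
    have hgap := hD k hkW h1 h2
    have hlt : p (k 1) ≤ (k 1).natAbs * G := by
      have : (p (k 1) : ℝ) ≤ (((k 1).natAbs * G : ℕ) : ℝ) := by linarith
      exact_mod_cast this
    have hceil : D ≤ (k 1).natAbs * G - p (k 1) := by
      refine Nat.ceil_le.mpr ?_
      rw [Nat.cast_sub hlt]; exact hgap
    have : ((p (k 1) + D : ℕ) : ℤ) ≤ (((k 1).natAbs * G : ℕ) : ℤ) := by exact_mod_cast (by omega)
    push_cast at this
    exact this
  have hWsym' : ∀ n ∈ Wm.image (fun k => k 1), -n ∈ Wm.image (fun k => k 1) := by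
    intro n hn
    obtain ⟨k, hk, rfl⟩ := Finset.mem_image.mp hn
    obtain ⟨hkW, h1, h2⟩ := hmem k hk
    refine Finset.mem_image.mpr ⟨Function.update k 1 (-k 1), ?_, by simp⟩
    refine Finset.mem_filter.mpr ⟨hWsym k hkW, ?_⟩
    simpa [abs_neg] using And.intro h1 h2
  have h := sum_window_iterate_vstep_ct_box_le P hγ hδ₀ hd hN₀ hρN a b has h0 hb hab j hR p Wm hW' hWp' hD0 hD' hWsym'
    hM hMδ hε
  -- monotonicity in the gap and in the block top; the half-open pass-through class
  have hΘ0 : 0 ≤ 2 * (P.N j : ℝ) * ((Real.sqrt ((2 * L + R : ℕ) * R) / R * 1) ^ 2 / 2 +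
      (Real.sqrt ((2 * L + R : ℕ) * R) / R * 1) ^ 2 / 2) := by positivity
  have hJ := ctJunk_mono (N := (P.N j : ℝ)) (Q := ((L + R : ℕ) : ℝ)) (Mc := 2 * ((L + R : ℕ) : ℝ) / P.N j + 1)
    hNr (Nat.cast_nonneg _) (by positivity) hΘ0 hDm hDle
  have hle : (((Λt - 1) * G : ℕ) : ℝ) ≤ ((Λt * G : ℕ) : ℝ) := by exact_mod_cast Nat.mul_le_mul_right G (Nat.sub_le Λt 1)
  have hR2 : (π * (((Λt - 1) * G : ℕ) : ℝ) * ε / P.N j) ^ 2 * 1 +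
        8 * M * P.δ j / π * ((Real.sqrt ((2 * L + R : ℕ) * R) / R * 1) ^ 2 / 2 +
          (Real.sqrt ((2 * L + R : ℕ) * R) / R * 1) ^ 2 / 2) ≤
      (π * ((Λt * G : ℕ) : ℝ) * ε / P.N j) ^ 2 * 1 +
        8 * M * P.δ j / π * ((Real.sqrt ((2 * L + R : ℕ) * R) / R * 1) ^ 2 / 2 +
          (Real.sqrt ((2 * L + R : ℕ) * R) / R * 1) ^ 2 / 2) := by
    refine add_le_add (mul_le_mul_of_nonneg_right (pow_le_pow_left₀ (by positivity)
      (div_le_div_of_nonneg_right (mul_le_mul_of_nonneg_right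
        (mul_le_mul_of_nonneg_left hle Real.pi_pos.le) hε0) hNr.le) 2) zero_le_one) le_rfl
  have hPT : ∑' k : Fin 2 → ℤ, (if (Λ : ℤ) ≤ |k 1| ∧ |k 1| ≤ ((Λt - 1 : ℕ) : ℤ) ∧ (L : ℤ) < |k 0| then (1 : ℝ) else 0) *
        ‖mFourierCoeff (fun x => (b j x : ℂ)) k‖ ^ 2 =
      ∑' k : Fin 2 → ℤ, (if (Λ : ℤ) ≤ |k 1| ∧ |k 1| < (Λt : ℤ) ∧ (L : ℤ) < |k 0| then (1 : ℝ) else 0) *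
        ‖mFourierCoeff (fun x => (b j x : ℂ)) k‖ ^ 2 := by
    refine tsum_congr fun k => ?_
    congr 1
    refine if_congr ?_ rfl rfl
    rw [hcast, Int.le_sub_one_iff]
  rw [hPT] at h
  exact h.trans (pow_le_pow_left₀ (by positivity)
    (add_le_add (add_le_add (Real.sqrt_le_sqrt hJ) (Real.sqrt_le_sqrt hR2)) le_rfl) 2)

/-- **One fibre block of an H-window of `b_j`, CT grade**: `…BlockScalarsCT.sum_window_iterate_hstep_ct_box_le` on the block
`W ∩ {Λ ≤ |k₀| < Λt}` (sources in `k₁`), real gap bound `D_m`, window symmetric under `k₀ ↦ −k₀`.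
[cite: Grafakos2014, Prop. 3.1.2 (5), Prop. 3.2.7 (3)] -/
theorem sum_block_iterate_hstep_ct_le {G : ℕ} (hγ : P.γ = G) (hδ₀ : 0 < P.δ₀) (hd : 0 < P.d) (hN₀ : 1 ≤ P.N₀)
    (hρN : 1 ≤ P.ρN) (a b : ℕ → UnitAddTorus (Fin 2) → ℝ) (has : ∀ j, IsSmooth (a j)) (h0 : a 0 = datum)
    (hb : ∀ j, b j = a j ∘ shearMap 0 1 (amp ⟨P.U j, P.U_periodic j, P.contDiff_U (P.δ_pos hδ₀ hd j)⟩ P.γ))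
    (hab : ∀ j, a (j + 1) = b j ∘ shearMap 1 0 (amp ⟨P.U j, P.U_periodic j, P.contDiff_U (P.δ_pos hδ₀ hd j)⟩ P.γ))
    (j : ℕ) (p : ℤ → ℕ) (W : Finset (Fin 2 → ℤ)) {Λ Λt L R : ℕ} (hΛt : 1 ≤ Λt) (hR : 0 < R)
    (hWp : ∀ k ∈ W, (Λ : ℤ) ≤ |k 0| → |k 0| < (Λt : ℤ) → |k 1| + ((L + R : ℕ) : ℤ) ≤ (p (k 0) : ℤ))
    {Dm : ℝ} (hDm : 0 < Dm)
    (hD : ∀ k ∈ W, (Λ : ℤ) ≤ |k 0| → |k 0| < (Λt : ℤ) → Dm ≤ (((k 0).natAbs * G : ℕ) : ℝ) - p (k 0))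
    (hWsym : ∀ k ∈ W, Function.update k 0 (-k 0) ∈ W)
    {M ε : ℝ} (hM : 1 ≤ M) (hMδ : M * P.δ j < π / 2) (hε : Real.exp (-(M ^ 2 / 2)) ≤ ε) :
    ∑ k ∈ W.filter (fun k => (Λ : ℤ) ≤ |k 0| ∧ |k 0| < (Λt : ℤ)), ‖mFourierCoeff (fun x => (b j x : ℂ)) k‖ ^ 2 ≤
      (Real.sqrt (3 * P.N j * (1 / (Dm + ((L + R : ℕ) : ℝ)) ^ 2 + 1 / (P.N j * (Dm + ((L + R : ℕ) : ℝ)))) /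
              π ^ 2 * (2 * P.N j * ((Real.sqrt ((2 * L + R : ℕ) * R) / R * 1) ^ 2 / 2 +
                (Real.sqrt ((2 * L + R : ℕ) * R) / R * 1) ^ 2 / 2)) +
            12 * (P.N j : ℝ) ^ 2 * ((L + R : ℕ) : ℝ) ^ 2 * (2 * ((L + R : ℕ) : ℝ) / P.N j + 1) *
              (1 / (Dm + ((L + R : ℕ) : ℝ)) ^ 2 + 1 / (P.N j * (Dm + ((L + R : ℕ) : ℝ)))) /
              (π ^ 2 * Dm ^ 2) * 1) +
          Real.sqrt ((π * ((Λt * G : ℕ) : ℝ) * ε / P.N j) ^ 2 * 1 +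
            8 * M * P.δ j / π * ((Real.sqrt ((2 * L + R : ℕ) * R) / R * 1) ^ 2 / 2 +
              (Real.sqrt ((2 * L + R : ℕ) * R) / R * 1) ^ 2 / 2)) +
        Real.sqrt (∑' k : Fin 2 → ℤ, (if (Λ : ℤ) ≤ |k 0| ∧ |k 0| < (Λt : ℤ) ∧ (L : ℤ) < |k 1| then (1 : ℝ) else 0) *
          ‖mFourierCoeff (fun x => (a j x : ℂ)) k‖ ^ 2)) ^ 2 := by
  classical
  have hNpos : 0 < P.N j := N_pos P hN₀ hρN j
  have hNr : (0 : ℝ) < P.N j := by exact_mod_cast hNpos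
  have hε0 : 0 ≤ ε := (Real.exp_pos _).le.trans hε
  set Wm : Finset (Fin 2 → ℤ) := W.filter (fun k => (Λ : ℤ) ≤ |k 0| ∧ |k 0| < (Λt : ℤ)) with hWm
  have hmem : ∀ k ∈ Wm, k ∈ W ∧ (Λ : ℤ) ≤ |k 0| ∧ |k 0| < (Λt : ℤ) := fun k hk => by
    simpa [hWm, Finset.mem_filter] using hk
  have hcast : (((Λt - 1 : ℕ) : ℤ)) = (Λt : ℤ) - 1 := by push_cast [Nat.cast_sub hΛt]; ring
  have hW' : ∀ k ∈ Wm, (Λ : ℤ) ≤ |k 0| ∧ |k 0| ≤ ((Λt - 1 : ℕ) : ℤ) := fun k hk => by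
    obtain ⟨-, h1, h2⟩ := hmem k hk
    exact ⟨h1, by rw [hcast]; exact Int.le_sub_one_iff.mpr h2⟩
  have hWp' : ∀ k ∈ Wm, |k 1| + ((L + R : ℕ) : ℤ) ≤ (p (k 0) : ℤ) := fun k hk => by
    obtain ⟨hkW, h1, h2⟩ := hmem k hk; exact hWp k hkW h1 h2
  set D : ℕ := ⌈Dm⌉₊ with hDdef
  have hD0 : 0 < D := Nat.ceil_pos.mpr hDm
  have hDle : Dm ≤ (D : ℝ) := Nat.le_ceil Dm
  have hD' : ∀ k ∈ Wm, (p (k 0) : ℤ) + D ≤ |k 0| * G := by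
    intro k hk
    obtain ⟨hkW, h1, h2⟩ := hmem k hk
    have hgap := hD k hkW h1 h2
    have hlt : p (k 0) ≤ (k 0).natAbs * G := by
      have : (p (k 0) : ℝ) ≤ (((k 0).natAbs * G : ℕ) : ℝ) := by linarith
      exact_mod_cast this
    have hceil : D ≤ (k 0).natAbs * G - p (k 0) := by
      refine Nat.ceil_le.mpr ?_
      rw [Nat.cast_sub hlt]; exact hgap
    have : ((p (k 0) + D : ℕ) : ℤ) ≤ (((k 0).natAbs * G : ℕ) : ℤ) := by exact_mod_cast (by omega)
    push_cast at this
    exact this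
  have hWsym' : ∀ n ∈ Wm.image (fun k => k 0), -n ∈ Wm.image (fun k => k 0) := by
    intro n hn
    obtain ⟨k, hk, rfl⟩ := Finset.mem_image.mp hn
    obtain ⟨hkW, h1, h2⟩ := hmem k hk
    refine Finset.mem_image.mpr ⟨Function.update k 0 (-k 0), ?_, by simp⟩
    refine Finset.mem_filter.mpr ⟨hWsym k hkW, ?_⟩
    simpa [abs_neg] using And.intro h1 h2
  have h := sum_window_iterate_hstep_ct_box_le P hγ hδ₀ hd hN₀ hρN a b has h0 hb hab j hR p Wm hW' hWp' hD0 hD' hWsym'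
    hM hMδ hε
  have hΘ0 : 0 ≤ 2 * (P.N j : ℝ) * ((Real.sqrt ((2 * L + R : ℕ) * R) / R * 1) ^ 2 / 2 +
      (Real.sqrt ((2 * L + R : ℕ) * R) / R * 1) ^ 2 / 2) := by positivity
  have hJ := ctJunk_mono (N := (P.N j : ℝ)) (Q := ((L + R : ℕ) : ℝ)) (Mc := 2 * ((L + R : ℕ) : ℝ) / P.N j + 1)
    hNr (Nat.cast_nonneg _) (by positivity) hΘ0 hDm hDle
  have hle : (((Λt - 1) * G : ℕ) : ℝ) ≤ ((Λt * G : ℕ) : ℝ) := by exact_mod_cast Nat.mul_le_mul_right G (Nat.sub_le Λt 1)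
  have hR2 : (π * (((Λt - 1) * G : ℕ) : ℝ) * ε / P.N j) ^ 2 * 1 +
        8 * M * P.δ j / π * ((Real.sqrt ((2 * L + R : ℕ) * R) / R * 1) ^ 2 / 2 +
          (Real.sqrt ((2 * L + R : ℕ) * R) / R * 1) ^ 2 / 2) ≤
      (π * ((Λt * G : ℕ) : ℝ) * ε / P.N j) ^ 2 * 1 +
        8 * M * P.δ j / π * ((Real.sqrt ((2 * L + R : ℕ) * R) / R * 1) ^ 2 / 2 +
          (Real.sqrt ((2 * L + R : ℕ) * R) / R * 1) ^ 2 / 2) := by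
    refine add_le_add (mul_le_mul_of_nonneg_right (pow_le_pow_left₀ (by positivity)
      (div_le_div_of_nonneg_right (mul_le_mul_of_nonneg_right
        (mul_le_mul_of_nonneg_left hle Real.pi_pos.le) hε0) hNr.le) 2) zero_le_one) le_rfl
  have hPT : ∑' k : Fin 2 → ℤ, (if (Λ : ℤ) ≤ |k 0| ∧ |k 0| ≤ ((Λt - 1 : ℕ) : ℤ) ∧ (L : ℤ) < |k 1| then (1 : ℝ) else 0) *
        ‖mFourierCoeff (fun x => (a j x : ℂ)) k‖ ^ 2 =
      ∑' k : Fin 2 → ℤ, (if (Λ : ℤ) ≤ |k 0| ∧ |k 0| < (Λt : ℤ) ∧ (L : ℤ) < |k 1| then (1 : ℝ) else 0) *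
        ‖mFourierCoeff (fun x => (a j x : ℂ)) k‖ ^ 2 := by
    refine tsum_congr fun k => ?_
    congr 1
    refine if_congr ?_ rfl rfl
    rw [hcast, Int.le_sub_one_iff]
  rw [hPT] at h
  exact h.trans (pow_le_pow_left₀ (by positivity)
    (add_le_add (add_le_add (Real.sqrt_le_sqrt hJ) (Real.sqrt_le_sqrt hR2)) le_rfl) 2)

end Cascade

end Summit.AnomalousDissipation.AnomalousDissipation.Theorems.SawtoothPulseCascade.K1Window
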